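import Mathlib
import HarnessLib
import Summits.HubbardSuperconductivity.HubbardSuperconductivity.Theorems.KLProgrammeH10TwoPointLimitPerturbedFermiRadiusSmooth
import Summits.HubbardSuperconductivity.HubbardSuperconductivity.Theorems.KLProgrammeKLRegimeSplitTwoLegF

/-!
# Route `KLProgramme` — the canonical perturbed Fermi radius `perturbedFermiRadius δ μ` and the frame's Fermi point
# `klFermiPoint μ K` are `Cⁿ` in the angle, with the first-order speed bound (named corollaries of p4's
# `…H10TwoPointLimitPerturbedFermiRadiusSmooth.contDiff_of_isRoot` / `abs_deriv_le` for the Hilbert-ε root)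

Cell gate-hubbard-kl, seat p1b (g4).  The Δ18 repair of crux K3's child `KLRegimeCountertermV7/V9` (stmt-HubbardSuperconductivity-19664)
and the engine's angular clause (E3g) `TwoLegAngularG` read the frame's Fermi point `klFermiPoint μ K θ = perturbedFermiRadius (−K) μ θ •
dir θ` (`…SplitTwoLegF`) as a function of `θ`; p4 g3 proved the implicit-function regularity for ANY selection of perturbed Fermi points
(`contDiff_of_isRoot`, K1 lane).  This file names it for the canonical selection and for the frame's curve point, so the consumers cite
one decl: `contDiff_perturbedFermiRadius`, `abs_deriv_perturbedFermiRadius_le` (`|u_E'| ≤ (4 + κ₁)·u_E/(Dt_min − κ₁)`),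
`TrigPolyC4v.contDiff_eval` (a frame is smooth on `Fin 2 → ℝ`), `contDiff_klFermiPoint`.  Hypotheses as in p4's files: `B : BandBounds a b`,
`δ ∈ Cⁿ` (`n ≠ 0`) with `|δ| ≤ κ₀`, `‖Dδ‖ ≤ κ₁` on the closed square, `[μ − κ₀, μ + κ₀] ⊂ [a, b]`, `κ₁ < Dt_min` (for a frame `K`:
`δ = −K`; the FrameOK-to-these-hypotheses bookkeeping stays with the consumer).  Proofs only; nothing is asserted about the model.
-/

noncomputable section

namespace Summit.HubbardSuperconductivity.HubbardSuperconductivity.Theorems.PerturbedFermiCurve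

set_option linter.dupNamespace false -- summit = problem name (single-conjunct summit), D-0017

open Real Set
open Literature.MathematicalPhysics.QuantumLattice Literature.MathematicalPhysics.QuantumLattice.BandSectorCounting

section Canonical

variable {a b : ℝ} (B : BandBounds a b) {δ : (Fin 2 → ℝ) → ℝ} {n : WithTop ℕ∞} (hδs : ContDiff ℝ n δ) (hn : n ≠ 0)
  {κ₀ κ₁ μ : ℝ} (hδ : ∀ k : Fin 2 → ℝ, (∀ i, |k i| ≤ π) → |δ k| ≤ κ₀) (hlo : a ≤ μ - κ₀) (hhi : μ + κ₀ ≤ b)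
  (hκ : ∀ k : Fin 2 → ℝ, (∀ i, |k i| ≤ π) → ‖fderiv ℝ δ k‖ ≤ κ₁) (hκ₁ : κ₁ < B.Dtmin)
include B hδs hn hδ hlo hhi hκ hκ₁

/-- **The canonical perturbed Fermi radius is `Cⁿ` in the angle.** -/
theorem contDiff_perturbedFermiRadius : ContDiff ℝ n (perturbedFermiRadius δ μ) :=
  contDiff_of_isRoot B hδs hn hδ hlo hhi hκ hκ₁ fun θ => isBandFermiRadius_perturbedFermiRadius B hδs.continuous hδ hlo hhi θ

/-- The canonical perturbed Fermi radius is differentiable. -/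
theorem differentiable_perturbedFermiRadius : Differentiable ℝ (perturbedFermiRadius δ μ) :=
  (contDiff_perturbedFermiRadius B hδs hn hδ hlo hhi hκ hκ₁).differentiable hn

/-- **First-order speed bound** (BGM (2.40) shape): `|u_E'(θ)| ≤ (4 + κ₁)·u_E(θ)/(Dt_min − κ₁)`. -/
theorem abs_deriv_perturbedFermiRadius_le (θ : ℝ) :
    |deriv (perturbedFermiRadius δ μ) θ| ≤ (4 + κ₁) * perturbedFermiRadius δ μ θ / (B.Dtmin - κ₁) :=
  abs_deriv_le B hδs hn hδ hlo hhi hκ hκ₁ (fun θ => isBandFermiRadius_perturbedFermiRadius B hδs.continuous hδ hlo hhi θ) θ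

/-- The perturbed Fermi point `u_E(θ)·dir θ` is `Cⁿ` in the angle. -/
theorem contDiff_perturbedFermiRadius_smul_dir : ContDiff ℝ n fun θ => perturbedFermiRadius δ μ θ • dir θ :=
  (contDiff_perturbedFermiRadius B hδs hn hδ hlo hhi hκ hκ₁).smul contDiff_dir

end Canonical

end Summit.HubbardSuperconductivity.HubbardSuperconductivity.Theorems.PerturbedFermiCurve

namespace Literature.MathematicalPhysics.QuantumLattice.TrigPolyC4v

/-- **A frame is smooth** as a function on `Fin 2 → ℝ` (finite sum of products of cosines of the coordinates). -/
theorem contDiff_eval (K : TrigPolyC4v) {n : WithTop ℕ∞} : ContDiff ℝ n K.eval := by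
  have h : K.eval = fun p : Fin 2 → ℝ => ∑ m ∈ Finset.range (K.degree + 1), ∑ k ∈ Finset.range (K.degree + 1),
      K.coeff m k * harmonic m k p := funext fun p => K.eval_def p
  rw [h]
  refine ContDiff.sum fun m _ => ContDiff.sum fun k _ => contDiff_const.mul ?_
  unfold harmonic
  have h0 : ContDiff ℝ n fun p : Fin 2 → ℝ => p 0 := contDiff_apply ℝ ℝ 0
  have h1 : ContDiff ℝ n fun p : Fin 2 → ℝ => p 1 := contDiff_apply ℝ ℝ 1
  exact (((Real.contDiff_cos.comp (contDiff_const.mul h0)).mul (Real.contDiff_cos.comp (contDiff_const.mul h1))).add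
    ((Real.contDiff_cos.comp (contDiff_const.mul h0)).mul (Real.contDiff_cos.comp (contDiff_const.mul h1)))).div_const _

end Literature.MathematicalPhysics.QuantumLattice.TrigPolyC4v

namespace Summit.HubbardSuperconductivity.HubbardSuperconductivity.Theorems.KLRegimeSplit

set_option linter.dupNamespace false -- summit = problem name (single-conjunct summit), D-0017

open Real Set
open Literature.MathematicalPhysics.QuantumLattice Literature.MathematicalPhysics.QuantumLattice.BandSectorCounting
open Summit.HubbardSuperconductivity.HubbardSuperconductivity.Theorems.PerturbedFermiCurve

/-- **The frame's Fermi point is `Cⁿ` in the angle**: for a frame `K` with `|K| ≤ κ₀` and `‖D K‖ ≤ κ₁` on the closed square,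
`[μ − κ₀, μ + κ₀] ⊂ [a, b]` (`B : BandBounds a b`) and `κ₁ < Dt_min`, `θ ↦ klFermiPoint μ K θ` is `Cⁿ` for every `n`. -/
theorem contDiff_klFermiPoint {a b : ℝ} (B : BandBounds a b) (K : TrigPolyC4v) {n : WithTop ℕ∞} (hn : n ≠ 0) {κ₀ κ₁ μ : ℝ}
    (hK : ∀ k : Fin 2 → ℝ, (∀ i, |k i| ≤ π) → |K.eval k| ≤ κ₀) (hlo : a ≤ μ - κ₀) (hhi : μ + κ₀ ≤ b)
    (hκ : ∀ k : Fin 2 → ℝ, (∀ i, |k i| ≤ π) → ‖fderiv ℝ (fun p => -K.eval p) k‖ ≤ κ₁) (hκ₁ : κ₁ < B.Dtmin) :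
    ContDiff ℝ n (klFermiPoint μ K) := by
  have hδs : ContDiff ℝ n (fun p : Fin 2 → ℝ => -K.eval p) := K.contDiff_eval.neg
  have hδ : ∀ k : Fin 2 → ℝ, (∀ i, |k i| ≤ π) → |(fun p : Fin 2 → ℝ => -K.eval p) k| ≤ κ₀ := fun k hk => by
    simpa [abs_neg] using hK k hk
  exact contDiff_perturbedFermiRadius_smul_dir B hδs hn hδ hlo hhi hκ hκ₁

/-- The first-order speed bound for the frame's Fermi radius: `|u_K'(θ)| ≤ (4 + κ₁)·u_K(θ)/(Dt_min − κ₁)`. -/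
theorem abs_deriv_frameFermiRadius_le {a b : ℝ} (B : BandBounds a b) (K : TrigPolyC4v) {κ₀ κ₁ μ : ℝ}
    (hK : ∀ k : Fin 2 → ℝ, (∀ i, |k i| ≤ π) → |K.eval k| ≤ κ₀) (hlo : a ≤ μ - κ₀) (hhi : μ + κ₀ ≤ b)
    (hκ : ∀ k : Fin 2 → ℝ, (∀ i, |k i| ≤ π) → ‖fderiv ℝ (fun p => -K.eval p) k‖ ≤ κ₁) (hκ₁ : κ₁ < B.Dtmin) (θ : ℝ) :
    |deriv (perturbedFermiRadius (fun p => -K.eval p) μ) θ| ≤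
      (4 + κ₁) * perturbedFermiRadius (fun p => -K.eval p) μ θ / (B.Dtmin - κ₁) := by
  have hδs : ContDiff ℝ 1 (fun p : Fin 2 → ℝ => -K.eval p) := K.contDiff_eval.neg
  have hδ : ∀ k : Fin 2 → ℝ, (∀ i, |k i| ≤ π) → |(fun p : Fin 2 → ℝ => -K.eval p) k| ≤ κ₀ := fun k hk => by
    simpa [abs_neg] using hK k hk
  exact abs_deriv_perturbedFermiRadius_le B hδs one_ne_zero hδ hlo hhi hκ hκ₁ θ

end Summit.HubbardSuperconductivity.HubbardSuperconductivity.Theorems.KLRegimeSplit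

end
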